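import Summits.Ventures.LatticeQCDFlow.Exactness.Phi4MetropolisPhaseLabelCarre
import HarnessLib

/-!
# `sgn M` under the local arm: a flip must CROSS `M = 0`, and an even step law reaches across with at most half its long increments

HONEST FRAMING: exact (Metropolis-corrected) sampling algorithms for lattice gauge theory;
figures of merit are autocorrelation/cost numbers at stated couplings and volumes; no
continuum-physics claim.  (SCALAR calibration rung S0-A: not a gauge result.)

Venture `LatticeQCDFlow` (cell pub-lqcd), topic `Exactness`; FANOUT row 2 (`s0-phi4`, LOCAL arm).
NEW WORK of the cell over `Exactness/Phi4MetropolisScan.lean` and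
`Exactness/Phi4MetropolisPhaseLabelCarre.lean`.  Nothing is cited as a fact.  For a general
coordinate-Lipschitz collective variable the label's carré du champ is `≤ 4 T` (previous file); for
the magnetisation itself a single-site update moves `M` by EXACTLY the increment `u`, so a sign flip
needs `u < −M` (from `M ≥ 0`) or `u ≥ −M` (from `M < 0`), and by EVENNESS of the step law these
one-sided events carry at most HALF of the mass of `{|u| ≥ |M|}` — the factor `2` instead of `4`.

## What is proved (`Λ = Fin (n+1)`; `ρ ≥ 0` even, integrable; `λ > 0` for the averaged form)

* `sum_update_eq_add` — `Σ (φ|φ_x:=t') = Σ φ + (t' − φ_x)`;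
* **`metroSite_signDev_le`**, **`metroScan_signDev_le`** —
  `M_x[(sgn M − sgn M(φ))²](φ) ≤ 2 ∫ 1{|M φ| ≤ |u|} ρ(u) du`, and the same for the scan `K`.

The floors are drawn in `Exactness/Phi4MetropolisSignTunnellingCSD.lean`.  NOT CLAIMED: anything
about the ordered sweep; any acceptance number.
-/

namespace Summit.Ventures.LatticeQCDFlow.Exactness

open Real MeasureTheory Filter Finset
open Summit.Ventures.LatticeQCDFlow.Scoring

section SignCarre

variable {n : ℕ}

/-! ## The crossing bound for `sgn M` -/

/-- A single-site update moves the magnetisation by the increment (re-export of the tree lemma in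
the form used below): `Σ (φ|φ_x:=t') = Σ φ + (t' − φ_x)`. -/
theorem sum_update_eq_add (φ : Fin (n + 1) → ℝ) (x : Fin (n + 1)) (t' : ℝ) :
    ∑ y, Function.update φ x t' y = (∑ y, φ y) + (t' - φ x) := by
  have h := sum_update_sub_sum φ x t'
  linarith

/-- **The hit's carré du champ of `sgn M`**: a flip of the sign needs an increment that CROSSES the
level (`u < −M` from `M ≥ 0`, `u ≥ −M` from `M < 0`), and by evenness of the step law such increments
carry at most half of the mass of `{|u| ≥ |M|}`:
`M_x[(sgn M − sgn M(φ))²](φ) ≤ 2 ∫ 1{|M φ| ≤ |u|} ρ(u) du`. -/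
theorem metroSite_signDev_le (J : Fin (n + 1) → Fin (n + 1) → ℝ) (lam : ℝ) {ρ : ℝ → ℝ}
    (hρ0 : ∀ u, 0 ≤ ρ u) (hρm : Measurable ρ) (hρi : Integrable ρ) (hρs : ∀ u, ρ (-u) = ρ u)
    (x : Fin (n + 1)) (φ : Fin (n + 1) → ℝ) :
    metroSite J lam ρ x (fun ψ => ((if 0 ≤ ∑ y, ψ y then (1 : ℝ) else -1)
        - (if 0 ≤ ∑ y, φ y then (1 : ℝ) else -1)) ^ 2) φ
      ≤ 2 * ∫ u, (if |∑ y, φ y| ≤ |u| then ρ u else 0) := by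
  set m : ℝ := ∑ y, φ y with hm
  have hρt : Integrable (fun t' => ρ (t' - φ x)) := hρi.comp_sub_right (φ x)
  -- indicator-restricted versions of `ρ` are integrable
  have hIi : ∀ (p : ℝ → Prop) [DecidablePred p], MeasurableSet {u | p u} →
      Integrable (fun u => if p u then ρ u else 0) := by
    intro p _ hp
    refine Integrable.mono' hρi ((Measurable.ite hp hρm measurable_const).aestronglyMeasurable)
      (Eventually.of_forall fun u => ?_)
    rw [Real.norm_eq_abs]
    split_ifs
    · rw [abs_of_nonneg (hρ0 _)]
    · rw [abs_zero]; exact hρ0 _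
  -- the crossing set from `φ`: `u < −m` if `m ≥ 0`, `−m ≤ u` if `m < 0`
  -- Step 1: the carré du champ is at most `4 ∫ 1{cross}(t' − φ_x) ρ(t' − φ_x) dt'`
  have hlow : MeasurableSet {u : ℝ | u < -m} := measurableSet_lt measurable_id measurable_const
  have hupp : MeasurableSet {u : ℝ | -m ≤ u} := measurableSet_le measurable_const measurable_id
  have hlow' : MeasurableSet {u : ℝ | m < u} := measurableSet_lt measurable_const measurable_id
  have hupp' : MeasurableSet {u : ℝ | u ≤ m} := measurableSet_le measurable_id measurable_const
  have habs : MeasurableSet {u : ℝ | |m| ≤ |u|} :=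
    measurableSet_le measurable_const measurable_id.abs
  -- evenness: `∫ 1{u < −m} ρ = ∫ 1{m < u} ρ` and `∫ 1{−m ≤ u} ρ = ∫ 1{u ≤ m} ρ`
  have hev1 : ∫ u, (if u < -m then ρ u else 0) = ∫ u, (if m < u then ρ u else 0) := by
    have h := integral_neg_eq_self (fun u => if m < u then ρ u else 0) (volume : Measure ℝ)
    rw [← h]
    refine integral_congr_ae (Eventually.of_forall fun u => ?_)
    show (if u < -m then ρ u else 0) = (if m < -u then ρ (-u) else 0)
    rw [hρs]
    have : (u < -m) ↔ (m < -u) := by constructor <;> intro h <;> linarith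
    simp only [this]
  have hev2 : ∫ u, (if -m ≤ u then ρ u else 0) = ∫ u, (if u ≤ m then ρ u else 0) := by
    have h := integral_neg_eq_self (fun u => if u ≤ m then ρ u else 0) (volume : Measure ℝ)
    rw [← h]
    refine integral_congr_ae (Eventually.of_forall fun u => ?_)
    show (if -m ≤ u then ρ u else 0) = (if -u ≤ m then ρ (-u) else 0)
    rw [hρs]
    have : (-m ≤ u) ↔ (-u ≤ m) := by constructor <;> intro h <;> linarith
    simp only [this]
  -- Step 2: the pair of one-sided masses is at most the reach mass `∫ 1{|m| ≤ |u|} ρ`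
  have hpair : (∫ u, (if 0 ≤ m then (if u < -m then ρ u else 0) + (if m < u then ρ u else 0)
          else (if -m ≤ u then ρ u else 0) + (if u ≤ m then ρ u else 0)))
      ≤ ∫ u, (if |m| ≤ |u| then ρ u else 0) := by
    refine integral_mono_of_nonneg (Eventually.of_forall fun u => ?_) (hIi _ habs)
      (Eventually.of_forall fun u => ?_)
    · simp only [Pi.zero_apply]
      split_ifs <;> linarith [hρ0 u]
    · dsimp only
      by_cases h0 : 0 ≤ m
      · rw [if_pos h0]
        by_cases hu : u < -m
        · have : ¬ (m < u) := by push Not; linarith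
          have habs' : |m| ≤ |u| := by
            rw [abs_of_nonneg h0, abs_of_neg (by linarith : u < 0)]; linarith
          rw [if_pos hu, if_neg this, if_pos habs', add_zero]
        · rw [if_neg hu, zero_add]
          by_cases hu' : m < u
          · have habs' : |m| ≤ |u| := by
              rw [abs_of_nonneg h0, abs_of_nonneg (by linarith : (0 : ℝ) ≤ u)]; linarith
            rw [if_pos hu', if_pos habs']
          · rw [if_neg hu']
            split_ifs
            · exact hρ0 u
            · exact le_rfl
      · have h0' : m < 0 := lt_of_not_ge h0
        rw [if_neg h0]
        by_cases hu : -m ≤ u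
        · have : ¬ (u ≤ m) := by push Not; linarith
          have habs' : |m| ≤ |u| := by
            rw [abs_of_neg h0', abs_of_nonneg (by linarith : (0 : ℝ) ≤ u)]; linarith
          rw [if_pos hu, if_neg this, if_pos habs', add_zero]
        · rw [if_neg hu, zero_add]
          by_cases hu' : u ≤ m
          · have habs' : |m| ≤ |u| := by
              rw [abs_of_neg h0', abs_of_nonpos (by linarith : u ≤ 0)]; linarith
            rw [if_pos hu', if_pos habs']
          · rw [if_neg hu']
            split_ifs
            · exact hρ0 u
            · exact le_rfl
  -- the two crossing integrals coincide by evenness, so `2 ∫ cross ≤ ∫ reach`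
  have hcrossInt : MeasurableSet {u : ℝ | (0 ≤ m ∧ u < -m) ∨ (m < 0 ∧ -m ≤ u)} := by
    have e : {u : ℝ | (0 ≤ m ∧ u < -m) ∨ (m < 0 ∧ -m ≤ u)}
        = ({u : ℝ | 0 ≤ m} ∩ {u | u < -m}) ∪ ({u : ℝ | m < 0} ∩ {u | -m ≤ u}) := by
      ext u
      simp only [Set.mem_setOf_eq, Set.mem_union, Set.mem_inter_iff]
    rw [e]
    exact ((MeasurableSet.const _).inter hlow).union ((MeasurableSet.const _).inter hupp)
  have h2cross : 2 * ∫ u, (if (0 ≤ m ∧ u < -m) ∨ (m < 0 ∧ -m ≤ u) then ρ u else 0)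
      ≤ ∫ u, (if |m| ≤ |u| then ρ u else 0) := by
    have hsame : ∫ u, (if (0 ≤ m ∧ u < -m) ∨ (m < 0 ∧ -m ≤ u) then ρ u else 0)
        = ∫ u, (if 0 ≤ m then (if u < -m then ρ u else 0) else (if -m ≤ u then ρ u else 0)) := by
      refine integral_congr_ae (Eventually.of_forall fun u => ?_)
      show (if (0 ≤ m ∧ u < -m) ∨ (m < 0 ∧ -m ≤ u) then ρ u else 0)
        = (if 0 ≤ m then (if u < -m then ρ u else 0) else (if -m ≤ u then ρ u else 0))
      by_cases h0 : 0 ≤ m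
      · simp only [h0, true_and, not_lt.mpr h0, false_and, or_false, if_true]
      · simp only [h0, false_and, lt_of_not_ge h0, true_and, false_or, if_false]
    have hsum : ∫ u, (if 0 ≤ m then (if u < -m then ρ u else 0) + (if m < u then ρ u else 0)
          else (if -m ≤ u then ρ u else 0) + (if u ≤ m then ρ u else 0))
        = 2 * ∫ u, (if 0 ≤ m then (if u < -m then ρ u else 0) else (if -m ≤ u then ρ u else 0)) := by
      by_cases h0 : 0 ≤ m
      · simp only [h0, if_true]
        rw [integral_add (hIi _ hlow) (hIi _ hlow'), ← hev1, two_mul]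
      · simp only [h0, if_false]
        rw [integral_add (hIi _ hupp) (hIi _ hupp'), ← hev2, two_mul]
    rw [hsame, ← hsum]
    exact hpair
  -- Step 3: the hit's carré du champ against the crossing mass
  have hcm : Measurable fun t' : ℝ =>
      (if (0 ≤ m ∧ t' - φ x < -m) ∨ (m < 0 ∧ -m ≤ t' - φ x) then ρ (t' - φ x) else 0) := by
    have hsub : Measurable fun t' : ℝ => t' - φ x := measurable_id.sub measurable_const
    exact Measurable.ite (hsub hcrossInt) (hρm.comp hsub) measurable_const
  have hci : Integrable (fun t' : ℝ =>
      (if (0 ≤ m ∧ t' - φ x < -m) ∨ (m < 0 ∧ -m ≤ t' - φ x) then ρ (t' - φ x) else 0)) := by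
    refine Integrable.mono' hρt hcm.aestronglyMeasurable (Eventually.of_forall fun t' => ?_)
    rw [Real.norm_eq_abs]
    split_ifs
    · rw [abs_of_nonneg (hρ0 _)]
    · rw [abs_zero]; exact hρ0 _
  have hshift : ∫ t', (if (0 ≤ m ∧ t' - φ x < -m) ∨ (m < 0 ∧ -m ≤ t' - φ x) then ρ (t' - φ x) else 0)
      = ∫ u, (if (0 ≤ m ∧ u < -m) ∨ (m < 0 ∧ -m ≤ u) then ρ u else 0) :=
    integral_sub_right_eq_self (μ := (volume : Measure ℝ))
      (fun u => if (0 ≤ m ∧ u < -m) ∨ (m < 0 ∧ -m ≤ u) then ρ u else 0) (φ x)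
  have hstep : metroSite J lam ρ x (fun ψ => ((if 0 ≤ ∑ y, ψ y then (1 : ℝ) else -1)
        - (if 0 ≤ ∑ y, φ y then (1 : ℝ) else -1)) ^ 2) φ
      ≤ 4 * ∫ u, (if (0 ≤ m ∧ u < -m) ∨ (m < 0 ∧ -m ≤ u) then ρ u else 0) := by
    unfold metroSite
    simp only [sub_self, zero_pow (two_ne_zero), mul_zero, add_zero]
    rw [← hshift, ← integral_const_mul]
    refine integral_mono_of_nonneg (Eventually.of_forall fun t' => ?_) (hci.const_mul 4)
      (Eventually.of_forall fun t' => ?_)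
    · obtain ⟨ha0, -⟩ := metroAccept_nonneg_le J lam x φ t'
      exact mul_nonneg (mul_nonneg ha0 (sq_nonneg _)) (hρ0 _)
    · obtain ⟨ha0, ha1⟩ := metroAccept_nonneg_le J lam x φ t'
      show metroAccept J lam x φ t' * ((if 0 ≤ ∑ y, Function.update φ x t' y then (1 : ℝ) else -1)
          - (if 0 ≤ ∑ y, φ y then (1 : ℝ) else -1)) ^ 2 * ρ (t' - φ x)
        ≤ 4 * (if (0 ≤ m ∧ t' - φ x < -m) ∨ (m < 0 ∧ -m ≤ t' - φ x) then ρ (t' - φ x) else 0)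
      rw [sum_update_eq_add φ x t', ← hm]
      by_cases hc : (0 ≤ m ∧ t' - φ x < -m) ∨ (m < 0 ∧ -m ≤ t' - φ x)
      · rw [if_pos hc]
        have h4 := label_sq_sub_le_four (0 ≤ m + (t' - φ x)) (0 ≤ m)
        calc metroAccept J lam x φ t' * ((if 0 ≤ m + (t' - φ x) then (1 : ℝ) else -1)
              - (if 0 ≤ m then (1 : ℝ) else -1)) ^ 2 * ρ (t' - φ x)
            ≤ 1 * 4 * ρ (t' - φ x) :=
              mul_le_mul_of_nonneg_right (mul_le_mul ha1 h4 (sq_nonneg _) zero_le_one) (hρ0 _)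
          _ = 4 * ρ (t' - φ x) := by ring
      · rw [if_neg hc]
        -- no crossing: the sign is unchanged
        have hsame : (if 0 ≤ m + (t' - φ x) then (1 : ℝ) else -1) = (if 0 ≤ m then (1 : ℝ) else -1) := by
          push Not at hc
          obtain ⟨hc1, hc2⟩ := hc
          by_cases h0 : 0 ≤ m
          · have := hc1 h0
            rw [if_pos h0, if_pos (by linarith)]
          · have h0' : m < 0 := lt_of_not_ge h0
            have := hc2 h0'
            rw [if_neg h0, if_neg (by push Not; linarith)]
        rw [hsame, sub_self, zero_pow two_ne_zero, mul_zero, zero_mul, mul_zero]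
  calc metroSite J lam ρ x (fun ψ => ((if 0 ≤ ∑ y, ψ y then (1 : ℝ) else -1)
        - (if 0 ≤ ∑ y, φ y then (1 : ℝ) else -1)) ^ 2) φ
      ≤ 4 * ∫ u, (if (0 ≤ m ∧ u < -m) ∨ (m < 0 ∧ -m ≤ u) then ρ u else 0) := hstep
    _ = 2 * (2 * ∫ u, (if (0 ≤ m ∧ u < -m) ∨ (m < 0 ∧ -m ≤ u) then ρ u else 0)) := by ring
    _ ≤ 2 * ∫ u, (if |m| ≤ |u| then ρ u else 0) := mul_le_mul_of_nonneg_left h2cross (by norm_num)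

/-- **The scan's carré du champ of `sgn M`**: `K[(sgn M − sgn M(φ))²](φ) ≤ 2 ∫ 1{|M φ| ≤ |u|} ρ(u) du`. -/
theorem metroScan_signDev_le (J : Fin (n + 1) → Fin (n + 1) → ℝ) (lam : ℝ) {ρ : ℝ → ℝ}
    (hρ0 : ∀ u, 0 ≤ ρ u) (hρm : Measurable ρ) (hρi : Integrable ρ) (hρs : ∀ u, ρ (-u) = ρ u)
    (φ : Fin (n + 1) → ℝ) :
    metroScan J lam ρ (fun ψ => ((if 0 ≤ ∑ y, ψ y then (1 : ℝ) else -1)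
        - (if 0 ≤ ∑ y, φ y then (1 : ℝ) else -1)) ^ 2) φ
      ≤ 2 * ∫ u, (if |∑ y, φ y| ≤ |u| then ρ u else 0) := by
  have hn : (0 : ℝ) < (n : ℝ) + 1 := by positivity
  unfold metroScan
  rw [div_le_iff₀ hn]
  calc ∑ x, metroSite J lam ρ x (fun ψ => ((if 0 ≤ ∑ y, ψ y then (1 : ℝ) else -1)
        - (if 0 ≤ ∑ y, φ y then (1 : ℝ) else -1)) ^ 2) φ
      ≤ ∑ _x : Fin (n + 1), 2 * ∫ u, (if |∑ y, φ y| ≤ |u| then ρ u else 0) :=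
        Finset.sum_le_sum fun x _ => metroSite_signDev_le J lam hρ0 hρm hρi hρs x φ
    _ = (2 * ∫ u, (if |∑ y, φ y| ≤ |u| then ρ u else 0)) * ((n : ℝ) + 1) := by
        rw [Finset.sum_const, Finset.card_univ, Fintype.card_fin, nsmul_eq_mul]
        push_cast
        ring

end SignCarre

end Summit.Ventures.LatticeQCDFlow.Exactness
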